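import Literature.AnabelianGeometry.EtaleTheta.LogDivisorModelTateTowerThetaTwistTowerSignFree

/-!
# [EtTh] Def. 3.3 (iii) / ERRATUM E2 on the ε-free tower `towerC₃sf`: ROOTS EXIST AFTER RAISING THE LEVEL — the algebraic core of the
# root law (file 3 of the 2c plan, part 1: roots and the congruence lemma; the covering bookkeeping is part 2)

S. Mochizuki, *The étale theta function …*, Publ. RIMS **45** (2009) [MochizukiEtTh2009], Def. 3.3 (iii) pp.73–74, Prop. 3.2 (iii) p.70;
ERRATUM E2 = [IUTchI] Rmk. 3.2.4 (i)(a) («for every `N ∈ ℕ_{≥1}`, `f` admits an `N`-th root over some tempered covering»)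
[cite: MochizukiEtTh2009, Def 3.3 (iii) p.73].

CLASS (b) MODEL, sequel (abc-iut cell, layer L2; seat abc-iut-L2-t3 (gen 7)) of `…ThetaTwistTowerSignFree` (`towerC₃sf`) — UNTOUCHED;
abc-iut-L2-d2's `N_mul_eN` / `upAdd_intCast` (p478618) BY NAME.
* `levelRoot n m q x` — the level-`m` root of a level-`n` function `x = (ζ, ϖ̈_n^c Ü_n^k Θ̈_n^t)` (sign-free): `(ζ_{N m}^{q ζ̃}, ϖ̈_m^{qc} Ü_m^{qk}
  Θ̈_m^{qt})`, `ζ̃ ∈ ℕ` a lift of `ζ` — the root of the ROOT OF UNITY exists because the modulus grows (`N_m = e · N_n`);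
* **`levelRoot_pow`**: for `eN n m = K · q` and `x` ε-FREE, `(levelRoot x)^K = resFn (upAdd h) (eN n m) x` — the `K`-th root of the
  transition of `x`; this is exactly where ε-freeness is needed (`K · ε_root = ε_x` has no solution for `ε_x = 1`, `K` even: this seat's
  FINDING #4); `levelRoot_mem_epsKer`;
* **`exists_pow_eq_resFn_towerC₃sf`**: in `towerC₃sf`, every level-`n` function has, for every `K ≥ 1`, a `K`-th root at level `n + K` of
  its transition — E2 (a) at the level of FUNCTIONS (the families over quotient coverings = part 2, abc-iut-L2-d2's `rootLawC` pattern);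
* `levelActFnMod_congr` — the level action depends only on the index-`n` classes, the index-`n` character value and the translation
  (the openness input of the stabiliser argument of part 2).
HONEST LABEL: class-(b) design model; nothing here bears on [IUTchIII] Cor. 3.12; no side taken; typed ≠ proved.
-/

noncomputable section

namespace Literature.AnabelianGeometry.EtaleTheta

open CategoryTheory Function

namespace LogDivisorModel

namespace TateTowerThetaTwist

open TateTowerTheta
open TateTowerKummerTwist (M Cst N coe_N N_dvd_M N_dvd_N eN N_mul_eN eN_pos MuN upAdd upAdd_intCast)
open TateTowerKummerTwistR (Kum)
open TateTowerKummerTwistRShear (Grp act thetaShear compat Compat levelsC)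

/-! ## The level action depends only on the index-`n` data -/

/-- `levelActFnMod n d hd g` depends only on the index-`n` classes, the index-`n` character value and the translation of `g`.
[cite: MochizukiEtTh2009, Def 3.3 (ii) p.73] -/
theorem levelActFnMod_congr (n d : ℕ) (hd : d ∣ M n) {g g' : Grp 3 thetaShear}
    (hk : Multiplicative.toAdd g.left n = Multiplicative.toAdd g'.left n) (hc : g.right.1 n = g'.right.1 n) (ha : g.right.2 = g'.right.2) :
    levelActFnMod n d hd g = levelActFnMod n d hd g' := by
  rw [levelActFnMod_apply, levelActFnMod_apply, ha]
  have h1 : kumActMod n d hd g.left = kumActMod n d hd g'.left := MulEquiv.ext fun x => by rw [kumActMod_apply, kumActMod_apply, hk]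
  have h2 : levelCharMod n d hd g.right.1 = levelCharMod n d hd g'.right.1 :=
    MulEquiv.ext fun z => by rw [levelCharMod_apply, levelCharMod_apply, hc]
  rw [h1, h2]

/-! ## Roots after raising the level -/

variable {n m : ℕ}

/-- **The level-`m` root** of a sign-free level-`n` function `(ζ, ϖ̈_n^c Ü_n^k Θ̈_n^t)`: `(ζ_{N m}^{q ζ̃}, ϖ̈_m^{qc} Ü_m^{qk} Θ̈_m^{qt})`.
[cite: MochizukiEtTh2009, Def 3.3 (iii) p.73] -/
def levelRoot (n m q : ℕ) (x : Fn (MuN n)) : Fn (MuN m) :=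
  (Multiplicative.ofAdd (((q * (Multiplicative.toAdd x.1).val : ℕ)) : ZMod (N m)),
    Multiplicative.ofAdd (((0 : ZMod 2), (q : ℤ) * eC (Multiplicative.toAdd x.2), (q : ℤ) * eU (Multiplicative.toAdd x.2),
      (q : ℤ) * eT (Multiplicative.toAdd x.2)) : Exp))

/-- The root is sign-free. [cite: MochizukiEtTh2009, Def 3.3 (iii) p.73] -/
theorem levelRoot_mem_epsKer (n m q : ℕ) (x : Fn (MuN n)) : levelRoot n m q x ∈ epsKer (ZMod (N m)) := rfl

/-- **`(levelRoot x)^K` is the transition of `x`** when `eN n m = K·q` and `x` is sign-free (the `μ`-part: `K·q·ζ̃ = e·ζ̃ = ι(ζ)`; the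
root exponents: `K·(q·v) = e·v`; the sign: `K·0 = 0 = ε_x`). [cite: MochizukiEtTh2009, Def 3.3 (iii) p.73] -/
theorem levelRoot_pow (hnm : n ≤ m) {K q : ℕ} (hq : eN n m = K * q) {x : Fn (MuN n)} (hx : x ∈ epsKer (ZMod (N n))) :
    levelRoot n m q x ^ K = resFn (upAdd hnm) (eN n m) x := by
  refine Prod.ext (Multiplicative.toAdd.injective ?_) (Multiplicative.toAdd.injective ?_)
  · change K • (((q * (Multiplicative.toAdd x.1).val : ℕ)) : ZMod (N m)) = upAdd hnm (Multiplicative.toAdd x.1)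
    conv_rhs => rw [← ZMod.natCast_zmod_val (Multiplicative.toAdd x.1), ← Int.cast_natCast, upAdd_intCast,
      Int.cast_natCast, ← Nat.cast_mul]
    rw [nsmul_eq_mul, ← Nat.cast_mul, ← mul_assoc, ← hq, Nat.mul_comm]
  · change K • (((0 : ZMod 2), (q : ℤ) * eC (Multiplicative.toAdd x.2), (q : ℤ) * eU (Multiplicative.toAdd x.2),
        (q : ℤ) * eT (Multiplicative.toAdd x.2)) : Exp) = resExp (eN n m) (Multiplicative.toAdd x.2)
    have hx' : (Multiplicative.toAdd x.2).1 = 0 := hx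
    refine ext_exp ?_ ?_ ?_ ?_
    · rw [Prod.smul_fst, smul_zero]
      exact hx'.symm
    · rw [eC_resExp, hq, Nat.cast_mul]
      change K • ((q : ℤ) * eC (Multiplicative.toAdd x.2)) = _
      rw [nsmul_eq_mul]; ring
    · rw [eU_resExp, hq, Nat.cast_mul]
      change K • ((q : ℤ) * eU (Multiplicative.toAdd x.2)) = _
      rw [nsmul_eq_mul]; ring
    · rw [eT_resExp, hq, Nat.cast_mul]
      change K • ((q : ℤ) * eT (Multiplicative.toAdd x.2)) = _
      rw [nsmul_eq_mul]; ring

/-- **E2 (a) at the level of functions on the ε-free tower**: every function of level `n` of `towerC₃sf` has, for every `K ≥ 1`, a `K`-th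
ROOT at level `n + K` of its transition. [cite: MochizukiEtTh2009, Def 3.3 (iii) p.73] -/
theorem exists_pow_eq_resFn_towerC₃sf (n : ℕ) (K : ℕ+)
    (h : (levelsC 3 thetaShear).closure (n + (K : ℕ)) ≤ (levelsC 3 thetaShear).closure n) (x : (towerC₃sf.Z n).Fn) :
    ∃ r : (towerC₃sf.Z (n + (K : ℕ))).Fn, r ^ (K : ℕ) = towerC₃sf.resFn h x := by
  -- `K ∣ K! ∣ eN n (n + K) = (n+1+K)!/(n+1)!` (abc-iut-w6-d058's / abc-iut-L2-d2's divisibility, re-derived from `N_mul_eN`)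
  obtain ⟨q, hq⟩ : (K : ℕ) ∣ eN n (n + (K : ℕ)) := by
    have h1 : (n + 1).factorial * (K : ℕ).factorial ∣ (n + 1 + (K : ℕ)).factorial :=
      Nat.factorial_mul_factorial_dvd_factorial_add _ _
    have h2 : (n + 1).factorial * eN n (n + (K : ℕ)) = (n + 1 + (K : ℕ)).factorial := by
      have h3 := N_mul_eN (Nat.le_add_right n (K : ℕ))
      rw [coe_N, coe_N, Nat.add_right_comm] at h3
      exact h3
    rw [← h2] at h1
    exact (Nat.dvd_factorial K.pos le_rfl).trans ((Nat.mul_dvd_mul_iff_left (Nat.factorial_pos _)).mp h1)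
  refine ⟨⟨levelRoot n (n + (K : ℕ)) q x.1, levelRoot_mem_epsKer _ _ _ _⟩, Subtype.ext ?_⟩
  show levelRoot n (n + (K : ℕ)) q x.1 ^ (K : ℕ) = resFn (upAdd (le_of_levelsC₃ h)) (eN n (n + (K : ℕ))) x.1
  exact levelRoot_pow (le_of_levelsC₃ h) hq x.2

/-- The sign element shows why ε-freeness is needed: on the UNRESTRICTED level functions, `(1, (−1)·1) = «−1»` has no square root at any
level (its would-be square root `r` needs `ε_r + ε_r = 1` in `ℤ/2`). [cite: MochizukiEtTh2009, Prop 3.2 (iii) p.70] -/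
theorem not_exists_sq_eq_sign (m : ℕ) :
    ¬ ∃ r : Fn (MuN m), r * r = (((1 : MuN m), Multiplicative.ofAdd (((1 : ZMod 2), (0 : ℤ), (0 : ℤ), (0 : ℤ)) : Exp)) : Fn (MuN m)) := by
  rintro ⟨r, hr⟩
  have h2 := congrArg (fun y : Fn (MuN m) => (Multiplicative.toAdd y.2).1) hr
  change (Multiplicative.toAdd r.2).1 + (Multiplicative.toAdd r.2).1 = (1 : ZMod 2) at h2
  rw [CharTwo.add_self_eq_zero] at h2
  exact zero_ne_one h2

end TateTowerThetaTwist

end LogDivisorModel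

end Literature.AnabelianGeometry.EtaleTheta

end
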